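import Summits.CriticalPhenomena.PercolationContinuityZ3.Theorems.SahiMasterFamilyPointwiseLower
import Summits.CriticalPhenomena.PercolationContinuityZ3.Theorems.SahiMasterFamilyFaceVanishingAllOrders
import Summits.CriticalPhenomena.PercolationContinuityZ3.Theorems.SahiMasterFamilyPointwisePrincipalCapFive

/-!
# DECREASING face-vanishing families (percolation: separation tuples all of whose single-edge deletion/contraction minors are zero
# flags): Sahi's `C_3, C_4, C_5` and the pointwise zero locus, by transfer

Unit `prim-master-conj` (crux anchor stmt-CriticalPhenomena-4575, helper work), gen 13; companion of `SahiMasterFamilyPointwiseLower.lean`.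
Complementing configurations (`SahiMasterFamilyLowerTransfer`) exchanges the two minors at a coordinate (`preimage_compl_secAt`:
`compl ⁻¹' X^{e←b} = (compl ⁻¹' X)^{e←¬b}`), so "face-vanishing" (every one-coordinate minor at the determining set is a zero flag) is invariant
(`faceVanishing_preimage_compl`), and the increasing-side theorems of this unit and of seat P4 transfer verbatim to DECREASING families:

* `sahiE_three/four/five_ind_lower_nonneg_of_faceVanishing` — **Sahi's `C_3, C_4, C_5` on every decreasing face-vanishing family** (every `p`);
* `sahiE_three/four/five_ind_lower_eq_zero_iff_of_faceVanishing` — **pointwise zero locus**: at every interior `p`, `E_k(μ_p; 1_D) = 0 ↔ D ∈ Z_k`;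
* GRAPH FORM (`k = 3`, the E3GRP rows of the cell): for three group separations `D_j = {X_j ↮ Y_j}` of a finite weighted graph such that for every
  edge `e` both minors `(D_0^{e←b}, D_1^{e←b}, D_2^{e←b})` (`b = 1`: edge forced open = contracted; `b = 0`: forced closed = deleted) form a zero flag,
  `E₃(μ_w; 1_{D_0}, 1_{D_1}, 1_{D_2}) ≥ 0` for every weight vector `w`, and `= 0` at an interior `w` iff `(D_0, D_1, D_2)` is itself a zero flag
  (`sahiE_groupSep_three_nonneg_of_faceVanishing`, `sahiE_groupSep_three_eq_zero_iff_of_faceVanishing`).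
Nothing here asserts `C_k` or (EQ-k) in general; axioms standard. [this work]
-/

noncomputable section

open scoped Classical
open scoped unitInterval

namespace Summit.CriticalPhenomena.PercolationContinuityZ3.Theorems

open Finset Function
open Literature.Combinatorics.Sahi2008
open Literature.Probability.LatticeModels (isUpperSet_preimage_compl isLowerSet_preimage_compl)
open Literature.Probability.Percolation (DeterminedBy determinedBy_iff)
open Literature.Probability.Percolation.DecisionTree (ind)

namespace Pointwise

variable {ι : Type} [Fintype ι]

/-! ### Minors and complementation -/

omit [Fintype ι] in
/-- Complementing a forced configuration forces the complement the other way. [folklore] -/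
theorem compl_forceAt (e : ι) (b : Bool) (ω : Set ι) : (forceAt e b ω)ᶜ = forceAt e (!b) ωᶜ := by
  cases b
  · ext i
    simp only [forceAt, cond_false, Bool.not_false, cond_true, Set.mem_compl_iff, Set.mem_sdiff, Set.mem_singleton_iff,
      Set.mem_insert_iff]
    tauto
  · ext i
    simp only [forceAt, cond_true, Bool.not_true, cond_false, Set.mem_compl_iff, Set.mem_insert_iff, Set.mem_sdiff,
      Set.mem_singleton_iff]
    tauto

omit [Fintype ι] in
/-- **Complementation exchanges the two minors at a coordinate**: `compl ⁻¹' X^{e←b} = (compl ⁻¹' X)^{e←¬b}`. [this work] -/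
theorem preimage_compl_secAt (e : ι) (b : Bool) (X : Set (Set ι)) :
    compl ⁻¹' secAt e b X = secAt e (!b) (compl ⁻¹' X) := by
  ext ω
  rw [Set.mem_preimage, mem_secAt, mem_secAt, Set.mem_preimage, compl_forceAt, Bool.not_not]

omit [Fintype ι] in
/-- **Face-vanishing is invariant under complementing configurations.** [this work] -/
theorem faceVanishing_preimage_compl {k : ℕ} (D : Fin k → Set (Set ι)) (S : Finset ι)
    (hall : ∀ e ∈ S, ∀ b : Bool, SuppZeroFlag k (fun j => secAt e b (D j))) :
    ∀ e ∈ S, ∀ b : Bool, SuppZeroFlag k (fun j => secAt e b (compl ⁻¹' D j)) := by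
  intro e he b
  have h := (suppZeroFlag_preimage_compl_iff k (fun j => secAt e (!b) (D j))).2 (hall e he (!b))
  have hfam : (fun j => compl ⁻¹' secAt e (!b) (D j)) = fun j => secAt e b (compl ⁻¹' D j) := by
    funext j; rw [preimage_compl_secAt, Bool.not_not]
  rwa [hfam] at h

/-! ### Decreasing face-vanishing families: positivity and the pointwise zero locus, orders 3, 4, 5 -/

/-- **`C₃` on every decreasing face-vanishing triple.** [this work] -/
theorem sahiE_three_ind_lower_nonneg_of_faceVanishing (p : ι → unitInterval) (D : Fin 3 → Set (Set ι)) (S : Finset ι)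
    (hD : ∀ j, IsLowerSet (D j)) (hDS : ∀ j, DeterminedBy (D j) (↑S : Set ι))
    (hall : ∀ e ∈ S, ∀ b : Bool, SuppZeroFlag 3 (fun j => secAt e b (D j))) :
    0 ≤ sahiE (bernoulliWeight p) 3 (fun j => ind (D j)) := by
  rw [sahiE_ind_eq_sahiE_ind_preimage_compl]
  exact sahiE_three_nonneg_of_faceVanishing ι _ (fun j => compl ⁻¹' D j) S (fun j => isUpperSet_preimage_compl (hD j))
    (fun j => (determinedBy_preimage_compl_iff (D j) _).2 (hDS j)) (faceVanishing_preimage_compl D S hall)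

/-- **Pointwise zero locus of a decreasing face-vanishing triple**: `E₃(μ_p; 1_D) = 0 ↔ D ∈ Z₃` at every interior `p`. [this work] -/
theorem sahiE_three_ind_lower_eq_zero_iff_of_faceVanishing (p : ι → unitInterval) (hp : ∀ e, (p e : ℝ) ∈ Set.Ioo (0 : ℝ) 1)
    (D : Fin 3 → Set (Set ι)) (S : Finset ι) (hD : ∀ j, IsLowerSet (D j)) (hDS : ∀ j, DeterminedBy (D j) (↑S : Set ι))
    (hall : ∀ e ∈ S, ∀ b : Bool, SuppZeroFlag 3 (fun j => secAt e b (D j))) :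
    sahiE (bernoulliWeight p) 3 (fun j => ind (D j)) = 0 ↔ SuppZeroFlag 3 D := by
  rw [sahiE_ind_eq_sahiE_ind_preimage_compl, ← suppZeroFlag_preimage_compl_iff 3 D]
  exact sahiE_three_ind_eq_zero_iff_of_faceVanishing ι _ ((symm_mem_Ioo_iff p).2 hp) (fun j => compl ⁻¹' D j) S
    (fun j => isUpperSet_preimage_compl (hD j)) (fun j => (determinedBy_preimage_compl_iff (D j) _).2 (hDS j))
    (faceVanishing_preimage_compl D S hall)

/-- **`C₄` on every decreasing face-vanishing quadruple.** [this work] -/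
theorem sahiE_four_ind_lower_nonneg_of_faceVanishing (p : ι → unitInterval) (D : Fin 4 → Set (Set ι)) (S : Finset ι)
    (hD : ∀ j, IsLowerSet (D j)) (hDS : ∀ j, DeterminedBy (D j) (↑S : Set ι))
    (hall : ∀ e ∈ S, ∀ b : Bool, SuppZeroFlag 4 (fun j => secAt e b (D j))) :
    0 ≤ sahiE (bernoulliWeight p) 4 (fun j => ind (D j)) := by
  rw [sahiE_ind_eq_sahiE_ind_preimage_compl]
  exact sahiE_four_ind_nonneg_of_faceVanishing _ (fun j => compl ⁻¹' D j) S (fun j => isUpperSet_preimage_compl (hD j))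
    (fun j => (determinedBy_preimage_compl_iff (D j) _).2 (hDS j)) (faceVanishing_preimage_compl D S hall)

/-- **Pointwise zero locus of a decreasing face-vanishing quadruple.** [this work] -/
theorem sahiE_four_ind_lower_eq_zero_iff_of_faceVanishing (p : ι → unitInterval) (hp : ∀ e, (p e : ℝ) ∈ Set.Ioo (0 : ℝ) 1)
    (D : Fin 4 → Set (Set ι)) (S : Finset ι) (hD : ∀ j, IsLowerSet (D j)) (hDS : ∀ j, DeterminedBy (D j) (↑S : Set ι))
    (hall : ∀ e ∈ S, ∀ b : Bool, SuppZeroFlag 4 (fun j => secAt e b (D j))) :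
    sahiE (bernoulliWeight p) 4 (fun j => ind (D j)) = 0 ↔ SuppZeroFlag 4 D := by
  rw [sahiE_ind_eq_sahiE_ind_preimage_compl, ← suppZeroFlag_preimage_compl_iff 4 D]
  exact sahiE_four_ind_eq_zero_iff_of_faceVanishing _ ((symm_mem_Ioo_iff p).2 hp) (fun j => compl ⁻¹' D j) S
    (fun j => isUpperSet_preimage_compl (hD j)) (fun j => (determinedBy_preimage_compl_iff (D j) _).2 (hDS j))
    (faceVanishing_preimage_compl D S hall)

/-- **`C₅` on every decreasing face-vanishing 5-family.** [this work] -/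
theorem sahiE_five_ind_lower_nonneg_of_faceVanishing (p : ι → unitInterval) (D : Fin 5 → Set (Set ι)) (S : Finset ι)
    (hD : ∀ j, IsLowerSet (D j)) (hDS : ∀ j, DeterminedBy (D j) (↑S : Set ι))
    (hall : ∀ e ∈ S, ∀ b : Bool, SuppZeroFlag 5 (fun j => secAt e b (D j))) :
    0 ≤ sahiE (bernoulliWeight p) 5 (fun j => ind (D j)) := by
  rw [sahiE_ind_eq_sahiE_ind_preimage_compl]
  exact sahiE_five_ind_nonneg_of_faceVanishing _ (fun j => compl ⁻¹' D j) S (fun j => isUpperSet_preimage_compl (hD j))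
    (fun j => (determinedBy_preimage_compl_iff (D j) _).2 (hDS j)) (faceVanishing_preimage_compl D S hall)

/-- **Pointwise zero locus of a decreasing face-vanishing 5-family.** [this work] -/
theorem sahiE_five_ind_lower_eq_zero_iff_of_faceVanishing (p : ι → unitInterval) (hp : ∀ e, (p e : ℝ) ∈ Set.Ioo (0 : ℝ) 1)
    (D : Fin 5 → Set (Set ι)) (S : Finset ι) (hD : ∀ j, IsLowerSet (D j)) (hDS : ∀ j, DeterminedBy (D j) (↑S : Set ι))
    (hall : ∀ e ∈ S, ∀ b : Bool, SuppZeroFlag 5 (fun j => secAt e b (D j))) :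
    sahiE (bernoulliWeight p) 5 (fun j => ind (D j)) = 0 ↔ SuppZeroFlag 5 D := by
  rw [sahiE_ind_eq_sahiE_ind_preimage_compl, ← suppZeroFlag_preimage_compl_iff 5 D]
  exact sahiE_five_ind_eq_zero_iff_of_faceVanishing _ ((symm_mem_Ioo_iff p).2 hp) (fun j => compl ⁻¹' D j) S
    (fun j => isUpperSet_preimage_compl (hD j)) (fun j => (determinedBy_preimage_compl_iff (D j) _).2 (hDS j))
    (faceVanishing_preimage_compl D S hall)

/-- **Every order, decreasing families**: P4's `PhiNonneg (j+4)` for `j ≤ n` gives Sahi's `C_{n+4}` on every decreasing face-vanishing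
`(n+4)`-family (transfer of `sahiE_ind_nonneg_of_faceVanishing_of_phiNonneg`). [this work] -/
theorem sahiE_ind_lower_nonneg_of_faceVanishing_of_phiNonneg (n : ℕ) (hΦ : ∀ j, j ≤ n → PrincipalCapBeta.PhiNonneg (j + 4))
    (p : ι → unitInterval) (D : Fin (n + 4) → Set (Set ι)) (S : Finset ι) (hD : ∀ j, IsLowerSet (D j))
    (hDS : ∀ j, DeterminedBy (D j) (↑S : Set ι)) (hall : ∀ e ∈ S, ∀ b : Bool, SuppZeroFlag (n + 4) (fun j => secAt e b (D j))) :
    0 ≤ sahiE (bernoulliWeight p) (n + 4) (fun j => ind (D j)) := by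
  rw [sahiE_ind_eq_sahiE_ind_preimage_compl]
  exact sahiE_ind_nonneg_of_faceVanishing_of_phiNonneg n hΦ ι _ (fun j => compl ⁻¹' D j) S
    (fun j => isUpperSet_preimage_compl (hD j)) (fun j => (determinedBy_preimage_compl_iff (D j) _).2 (hDS j))
    (faceVanishing_preimage_compl D S hall)

end Pointwise

/-! ### Graph form: triples of group separations -/

namespace Pointwise

open Literature.Probability.Percolation

variable {V : Type} [Fintype V]

/-- **`C₃` for face-vanishing triples of group separations**: if for every edge `e` both single-edge minors of the triple
`({X_0 ↮ Y_0}, {X_1 ↮ Y_1}, {X_2 ↮ Y_2})` form a zero flag, then `E₃(μ_w; …) ≥ 0` for every edge-weight vector `w`. [this work] -/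
theorem sahiE_groupSep_three_nonneg_of_faceVanishing (w : Sym2 V → unitInterval) (X Y : Fin 3 → Set V)
    (hall : ∀ (e : Sym2 V) (b : Bool), SuppZeroFlag 3 (fun j =>
      secAt e b {ω : BondConfig V | ∀ x ∈ X j, ∀ y ∈ Y j, ¬ (openGraph ω).Reachable x y})) :
    0 ≤ sahiE (bernoulliWeight w) 3 (fun j => ind {ω : BondConfig V | ∀ x ∈ X j, ∀ y ∈ Y j, ¬ (openGraph ω).Reachable x y}) :=
  sahiE_three_ind_lower_nonneg_of_faceVanishing w _ univ (fun j => isLowerSet_groupSep (X j) (Y j))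
    (fun j => by rw [coe_univ, determinedBy_iff]; intro ω ω' h; rw [Set.inter_univ, Set.inter_univ] at h; rw [h])
    (fun e _ b => hall e b)

/-- **Pointwise zero locus for face-vanishing triples of group separations**: with every single-edge minor a zero flag, at every interior
weight vector `E₃ = 0` iff the triple itself is a zero flag. [this work] -/
theorem sahiE_groupSep_three_eq_zero_iff_of_faceVanishing (w : Sym2 V → unitInterval) (hw : ∀ e, (w e : ℝ) ∈ Set.Ioo (0 : ℝ) 1)
    (X Y : Fin 3 → Set V)
    (hall : ∀ (e : Sym2 V) (b : Bool), SuppZeroFlag 3 (fun j =>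
      secAt e b {ω : BondConfig V | ∀ x ∈ X j, ∀ y ∈ Y j, ¬ (openGraph ω).Reachable x y})) :
    sahiE (bernoulliWeight w) 3 (fun j => ind {ω : BondConfig V | ∀ x ∈ X j, ∀ y ∈ Y j, ¬ (openGraph ω).Reachable x y}) = 0 ↔
      SuppZeroFlag 3 fun j => {ω : BondConfig V | ∀ x ∈ X j, ∀ y ∈ Y j, ¬ (openGraph ω).Reachable x y} :=
  sahiE_three_ind_lower_eq_zero_iff_of_faceVanishing w hw _ univ (fun j => isLowerSet_groupSep (X j) (Y j))
    (fun j => by rw [coe_univ, determinedBy_iff]; intro ω ω' h; rw [Set.inter_univ, Set.inter_univ] at h; rw [h])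
    (fun e _ b => hall e b)

end Pointwise

end Summit.CriticalPhenomena.PercolationContinuityZ3.Theorems
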